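import Literature.Geometry.Riemannian.BaerHankeMeanCurvatureIncrease
import HarnessLib

/-!
# Stub `stub_bh28` of the line `registered` (crux `CorkRegluablePsc`, stmt-SmoothPoincare4-3206)

The registered stub `stub_bh28` of the skeleton `Cruxes/CorkRegluablePsc/Lines/birth.lean` is
LITERALLY the tree's named fact
`Literature.Geometry.Riemannian.BarHanke2023_prop28_meanCurvatureIncrease` (Bär–Hanke 2023,
§3 Prop. 28, point family, `σ = 0`, `s = 1`: the outward un-normalised mean curvature of a PSC
metric on a compact manifold with boundary can be raised by a positive constant keeping the
induced boundary form, the unit normal and `scal > 0`), vendored in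
`Literature/Geometry/Riemannian/BaerHankeNormalForm.lean`.  The fact is DISCHARGED in the tree by
`Literature.Geometry.Riemannian.BarHanke2023_prop28_meanCurvatureIncrease_holds`
(`Literature/Geometry/Riemannian/BaerHankeMeanCurvatureIncrease.lean`, following the printed
proof: boundary normal coordinates of an extension to the double, conformal deformation
`e^{-δψ(t)} g_t + dt²` of the slices, `H ↦ H + ½δ(m+1)`, small `δ` by continuity of `scal` and
compactness), so the stub closes by `exact`.

* `stub_bh28` — the registered signature, closed by the discharge.

[cite: BarHanke2023, §3 Prop. 28 and its proof (arXiv:2012.09127, p. 13)]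
-/

-- the prescribed namespace `Summit.<P>.<Sub>.…` duplicates `SmoothPoincare4` (P = Sub)
set_option linter.dupNamespace false

namespace Summit.SmoothPoincare4.SmoothPoincare4.Theorems

/-- **Stub `stub_bh28` (Bär–Hanke 2023, Prop. 28)**: the named fact
`Literature.Geometry.Riemannian.BarHanke2023_prop28_meanCurvatureIncrease`, closed by the tree's
discharge `BarHanke2023_prop28_meanCurvatureIncrease_holds`.
[cite: BarHanke2023, §3 Prop. 28 (arXiv:2012.09127, p. 13)] -/
theorem stub_bh28 : Literature.Geometry.Riemannian.BarHanke2023_prop28_meanCurvatureIncrease :=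
  Literature.Geometry.Riemannian.BarHanke2023_prop28_meanCurvatureIncrease_holds

end Summit.SmoothPoincare4.SmoothPoincare4.Theorems
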